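/-
Copyright (c) 2026. Released under the Apache 2.0 license.
-/
import Literature.NumberTheory.EllipticCurves.QuadraticTwistNegOneMinimalDiscriminant
import Literature.NumberTheory.EllipticCurves.Pal2012.QuadraticTwistPeriodProofs
import Literature.NumberTheory.EllipticCurves.QuadraticTwistAtTwoMinimalModelProofs
import Literature.NumberTheory.EllipticCurves.KrausNonMinimalityTwoThreeProofs
import Literature.NumberTheory.EllipticCurves.BSDRootNumberLocalTablesProofs
import Literature.NumberTheory.EllipticCurves.CanonicalPAdicHeightRestrictionProofs
import HarnessLib

/-!
# Connell–Pal at `d = −1` for two curves additive at `2`: `Δ(W′) = Δ(W)` — PROVED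

Sibling *proofs* file (theorems only: **no definition, no named fact**; net Literature debt `−1`) of
`Literature.NumberTheory.EllipticCurves.QuadraticTwistNegOneMinimalDiscriminant`, DISCHARGING its named
fact `Literature.NumberTheory.EllipticCurves.connellPal_Δ_eq_of_negOne_twist_of_four_dvd_conductor`
(`…_holds` at the end of this file): for globally minimal `W`, `W′ / ℚ` with `2² ∣ N(W)`, `2² ∣ N(W′)`
and `u • (W ⊗ (−1)) = W′` for a `ℚ`-isomorphism `u`, `Δ(W′) = Δ(W)` — V. Pal, *Periods of quadratic
twists of elliptic curves*, Proc. AMS 140 (2012), Prop. 2.4 (Connell, *Elliptic Curve Handbook* 5.7.3,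
corrected), the global corollary at `d = −1` with both curves additive at `2` (the derivation (a)–(c) of
the statement file's module docstring).

## Proof (Pal, Prop. 2.4–2.5 = Connell's computation of the scaling `u`, in the tree's vocabulary)

Write `μ = u(u) ∈ ℚˣ`.  As in `Pal2012/QuadraticTwistPeriodProofs` (the case `d ≡ 1 (mod 4)`), it
suffices to show that `μ` is a unit at every finite place `v` of `ℚ`: then `μ, μ⁻¹ ∈ ℤ`, `μ = ±1`
(`HeightOneSpectrum.mem_integers_of_valuation_le_one`), and
`Δ(W′) = μ⁻¹² · (−1)⁶ · Δ(W) = Δ(W)` (`variableChange_Δ`, `quadraticTwist_Δ`; Pal Remark 2.3).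

* **Odd places** (Pal Prop. 2.4, "if `p` is an odd prime not dividing `d`, then `v_p(Δ′) = v_p(Δ)`";
  Prop. 2.5, `u_ℓ = 1`): the tree theorem
  `WeierstrassCurve.valuation_u_eq_one_of_smul_quadraticTwist_of_odd_of_not_dvd` at `d = −1`.
* **The place `2`** (Pal Prop. 2.4, `p = 2`, `d ≡ 3 (mod 4)`, case (iii) "otherwise
  `v₂(Δ′) = v₂(Δ)`", cases (i)/(ii) being excluded because one side would be semistable at `2`).
  Instead of Connell's `2`-adic signature table the proof here runs through Kraus's criterion at `2`
  (Kraus 1989, Prop. 2), in the constructive form already in the tree: for the `ℤ`-models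
  `M = integralModelInt W`, `M′ = integralModelInt W′` one has `c₄(M′) = μ⁻⁴ c₄(M)`,
  `c₆(M′) = −μ⁻⁶ c₆(M)` (`quadraticTwist_c₄`, `quadraticTwist_c₆`, `variableChange_c₄`,
  `variableChange_c₆`).  A globally minimal equation ADDITIVE at `2` has `a₁, a₃` even — `a₁` odd gives
  `c₄` odd (`odd_c₄_of_odd_a₁`) and `a₁` even, `a₃` odd gives `Δ` odd (`odd_Δ_of_even_a₁_of_odd_a₃`),
  against `2 ∣ c₄`, `2 ∣ Δ` (`hasAdditiveReductionAt_iff_of_isMinimalAt`, Silverman *AEC* VII.5.1(c)) —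
  hence `16 ∣ c₄` (`sixteen_dvd_c₄_of_even_a₁`) and `32 ∣ c₆` (`thirtytwo_dvd_c₆_of_even_a₁_of_even_a₃`,
  the case `a₁, a₃` even of Kraus's necessary condition).  If `ord₂(μ) ≥ 1` then
  `c₄(M) = μ⁴ c₄(M′)`, `c₆(M) = −μ⁶ c₆(M′)` give `2⁸ ∣ c₄(M)` and `2¹¹ ∣ c₆(M)`, which a `2`-minimal
  equation never satisfies (`WeierstrassCurve.not_pow_dvd_c₄_c₆_int_two`: the scaling `u = 2` of the
  short normal form would be `2`-integral — the constructive instance `16 ∣ c₄, c₆ ≡ 0 (32)` of Kraus's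
  criterion); symmetrically `ord₂(μ) ≤ −1` is impossible by the minimality of `M′`.  So `ord₂(μ) = 0`
  (`padicValRat`), i.e. `μ` is a `2`-adic unit (`valuation_ratCast_eq_one_of_padicValRat_eq_zero`).
  This is Pal's/Connell's case analysis read backwards: `v₂(Δ′) = v₂(Δ) ± 12` forces the side with the
  smaller discriminant to have `2`-adic signature `0,0,c` or `a,3,0`, i.e. to be semistable at `2`.

Consumer: `Summit.BirchSwinnertonDyer.Rank1Residual.ManinAdditive.minusOneOrbitManinEq_of_connellPal`
(`MinusOneOrbitManinEqOfPrint.lean`, cell `bsd-f2-manin`): THEOREM I of that cell was conditional on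
exactly this printed input.  HONEST FRAMING: an elementary statement about minimal discriminants of
`χ₋₄`-twists; nothing here proves anything about BSD.

## References
* [Pal2012] V. Pal, *Periods of quadratic twists of elliptic curves*, Proc. Amer. Math. Soc. 140
  (2012) 1513–1525 (= arXiv:1012.0094): Prop. 2.4 (Connell) p. 4, Remark 2.3, Prop. 2.5.
* [Connell1999] I. Connell, *Elliptic Curve Handbook* (1999), §5.7.3.
* [Kraus1989] A. Kraus, *Quelques remarques à propos des invariants `c₄`, `c₆` et `Δ` d'une courbe
  elliptique*, Acta Arith. 54 (1989) 75–80, Prop. 2.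
* [SilvermanAEC2009] J. H. Silverman, *The Arithmetic of Elliptic Curves*, 2nd ed. (2009): III.1
  Table 3.1, VII.1 Prop. 1.3(b) and Remark 1.1, VII.5 Prop. 5.1, VIII.8.

## Design notes
Theorems only; deliberate dot-notation extensions of Mathlib's `WeierstrassCurve` namespace for the
local lemmas (as in `Pal2012/QuadraticTwistPeriodProofs`, `KrausNonMinimalityTwoThreeProofs`), the
parity lemma next to its siblings in `Literature.NumberTheory.EllipticCurves`
(`QuadraticTwistAtTwoMinimalModelProofs`), and the discharge in the fact's namespace.
-/

noncomputable section

open scoped Classical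

open NumberField IsDedekindDomain IsDedekindDomain.HeightOneSpectrum Rat.HeightOneSpectrum

namespace Literature.NumberTheory.EllipticCurves

/-! ## The case `a₁, a₃` even of Kraus's condition at `2`: `32 ∣ c₆` -/

/-- `a₁` and `a₃` even ⟹ `32 ∣ c₆` (`4 ∣ b₂`, `2 ∣ b₄`, `4 ∣ b₆`, so
`c₆ = −b₂³ + 36 b₂ b₄ − 216 b₆ ≡ 0 (mod 32)`; with `sixteen_dvd_c₄_of_even_a₁` this is the case
`16 ∣ c₄, c₆ ≡ 0 (mod 32)` of Kraus's necessary condition at `2`; the formulae of Silverman *AEC*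
III.1). [cite: Kraus1989, Prop. 2] [cite: SilvermanAEC2009, III.1 (b₂, b₄, b₆, c₆)] -/
theorem thirtytwo_dvd_c₆_of_even_a₁_of_even_a₃ (M : WeierstrassCurve ℤ) (h₁ : Even M.a₁)
    (h₃ : Even M.a₃) : (32 : ℤ) ∣ M.c₆ := by
  obtain ⟨x, hx⟩ := h₁
  obtain ⟨y, hy⟩ := h₃
  refine ⟨-2 * (x ^ 2 + M.a₂) ^ 3 + 9 * (x ^ 2 + M.a₂) * (M.a₄ + 2 * x * y)
    - 27 * (y ^ 2 + M.a₆), ?_⟩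
  simp only [WeierstrassCurve.c₆, WeierstrassCurve.b₂, WeierstrassCurve.b₄, WeierstrassCurve.b₆,
    hx, hy]
  ring

end Literature.NumberTheory.EllipticCurves

namespace WeierstrassCurve

open Literature.NumberTheory.EllipticCurves

variable (V : WeierstrassCurve ℚ) [V.IsElliptic] [V.IsGloballyMinimal]

/-! ## Additive at `2`: `16 ∣ c₄` and `32 ∣ c₆` for the global minimal equation -/

/-- **A globally minimal equation over `ℚ` which is additive at `2` has `2 ∣ c₄` and `2 ∣ Δ`**
(`2² ∣ N` iff additive reduction at `2`, Silverman *ATAEC* IV.10.2(c),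
`natGenerator_sq_dvd_conductorNorm_iff`; for a minimal equation additive reduction reads
`ord₂(Δ) > 0`, `ord₂(c₄) > 0`, *AEC* VII.5.1(c), `hasAdditiveReductionAt_iff_of_isMinimalAt`).
[cite: SilvermanAEC2009, VII.5 Prop. 5.1(c)] [cite: Silverman1994, IV.10.2(c)] -/
theorem two_dvd_c₄_and_two_dvd_Δ_of_four_dvd_conductorNorm (h4 : 2 ^ 2 ∣ V.conductorNorm ℤ) :
    (2 : ℤ) ∣ (integralModelInt V).c₄ ∧ (2 : ℤ) ∣ (integralModelInt V).Δ := by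
  set M : WeierstrassCurve ℤ := integralModelInt V with hM
  have hVM : M.map (Int.castRingHom ℚ) = V := map_integralModelInt V
  -- the place of `ℤ` under `2` and the place of `𝓞 ℚ` over `2`
  set v₀ : HeightOneSpectrum ℤ := (primesEquiv (R := ℤ)).symm ⟨2, Nat.prime_two⟩ with hv₀
  have hgen₀ : natGenerator v₀ = 2 :=
    congrArg Subtype.val ((primesEquiv (R := ℤ)).apply_symm_apply ⟨2, Nat.prime_two⟩)
  set v : HeightOneSpectrum (𝓞 ℚ) := (primesEquiv (R := 𝓞 ℚ)).symm ⟨2, Nat.prime_two⟩ with hv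
  have hgen : natGenerator v = 2 :=
    congrArg Subtype.val ((primesEquiv (R := 𝓞 ℚ)).apply_symm_apply ⟨2, Nat.prime_two⟩)
  have hgenZ : (natGenerator v : ℤ) = 2 := by exact_mod_cast hgen
  -- additive at `v₀`, hence at `v`
  have hadd₀ : V.HasAdditiveReductionAt v₀ := by
    rw [← natGenerator_sq_dvd_conductorNorm_iff v₀ V, hgen₀]
    exact h4
  have hadd : V.HasAdditiveReductionAt v :=
    (V.hasAdditiveReductionAt_int_iff_ringOfIntegers ⟨2, Nat.prime_two⟩).mp hadd₀
  have hmin : V.IsMinimalAt v := IsGloballyMinimal.isMinimal v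
  obtain ⟨hΔ, hc₄⟩ := (hasAdditiveReductionAt_iff_of_isMinimalAt hmin).mp hadd
  have hΔ' : v.valuation ℚ ((M.Δ : ℤ) : ℚ) < 1 := by
    rw [← hVM, map_Δ, eq_intCast] at hΔ
    exact hΔ
  have hc₄' : v.valuation ℚ ((M.c₄ : ℤ) : ℚ) < 1 := by
    rw [← hVM, map_c₄, eq_intCast] at hc₄
    exact hc₄
  constructor
  · by_contra hn
    have h1 := Literature.NumberTheory.GaloisRepresentations.Rat.valuation_intCast_eq_one v
      (n := M.c₄) (by rwa [hgenZ])
    exact hc₄'.ne h1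
  · by_contra hn
    have h1 := Literature.NumberTheory.GaloisRepresentations.Rat.valuation_intCast_eq_one v
      (n := M.Δ) (by rwa [hgenZ])
    exact hΔ'.ne h1

/-- **A globally minimal equation over `ℚ` which is additive at `2` has `16 ∣ c₄` and `32 ∣ c₆`**: its
coefficients `a₁, a₃` are both even (`a₁` odd would make `c₄` odd, `a₁` even and `a₃` odd would make
`Δ` odd), and then `16 ∣ c₄ = b₂² − 24 b₄`, `32 ∣ c₆` — the case `16 ∣ c₄, c₆ ≡ 0 (mod 32)` of Kraus's
necessary condition at `2`; in Connell's language, the `2`-adic signature `(v₂(c₄), v₂(c₆), v₂(Δ))`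
of a minimal equation additive at `2` is neither `0,0,c` nor `a,3,0`.
[cite: Kraus1989, Prop. 2] [cite: Pal2012, Prop. 2.4 (Connell), case p = 2]
[cite: SilvermanAEC2009, VII.5 Prop. 5.1(c)] -/
theorem sixteen_dvd_c₄_and_thirtytwo_dvd_c₆_of_four_dvd_conductorNorm
    (h4 : 2 ^ 2 ∣ V.conductorNorm ℤ) :
    (16 : ℤ) ∣ (integralModelInt V).c₄ ∧ (32 : ℤ) ∣ (integralModelInt V).c₆ := by
  set M : WeierstrassCurve ℤ := integralModelInt V with hM
  obtain ⟨h2c₄, h2Δ⟩ := V.two_dvd_c₄_and_two_dvd_Δ_of_four_dvd_conductorNorm h4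
  rcases Int.even_or_odd M.a₁ with h₁ | h₁
  · rcases Int.even_or_odd M.a₃ with h₃ | h₃
    · exact ⟨sixteen_dvd_c₄_of_even_a₁ M h₁, thirtytwo_dvd_c₆_of_even_a₁_of_even_a₃ M h₁ h₃⟩
    · exact absurd h2Δ (odd_Δ_of_even_a₁_of_odd_a₃ M h₁ h₃)
  · exact absurd h2c₄ (odd_c₄_of_odd_a₁ M h₁)

/-! ## The place `2`: the scaling between the two minimal equations is a `2`-adic unit -/

/-- **Kraus's constructive non-minimality, valuation form.** Let `X, Y / ℚ` be globally minimal
elliptic curves with `ℤ`-models `M_X`, `M_Y`, and `t ∈ ℚˣ` with `c₄(M_X) = t⁴ c₄(M_Y)`,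
`c₆(M_X) = −t⁶ c₆(M_Y)`, where `16 ∣ c₄(M_Y)` and `32 ∣ c₆(M_Y)`.  Then `ord₂(t) ≤ 0`: otherwise
`2⁸ ∣ c₄(M_X)` and `2¹¹ ∣ c₆(M_X)`, impossible for the `2`-minimal `M_X`
(`not_pow_dvd_c₄_c₆_int_two`). [cite: Kraus1989, Prop. 2] [cite: SilvermanAEC2009, VII.1 Remark 1.1] -/
theorem padicValRat_two_le_zero_of_c₄_c₆_eq (X Y : WeierstrassCurve ℚ) [X.IsElliptic]
    [X.IsGloballyMinimal] [Y.IsGloballyMinimal]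
    (hY : (16 : ℤ) ∣ (integralModelInt Y).c₄ ∧ (32 : ℤ) ∣ (integralModelInt Y).c₆)
    {t : ℚ} (ht : t ≠ 0)
    (h₄ : ((integralModelInt X).c₄ : ℚ) = t ^ 4 * ((integralModelInt Y).c₄ : ℚ))
    (h₆ : ((integralModelInt X).c₆ : ℚ) = -(t ^ 6 * ((integralModelInt Y).c₆ : ℚ))) :
    padicValRat 2 t ≤ 0 := by
  haveI : Fact (Nat.Prime 2) := ⟨Nat.prime_two⟩
  by_contra hlt
  have h1 : 1 ≤ padicValRat 2 t := by
    have h := not_le.mp hlt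
    exact_mod_cast Int.add_one_le_iff.mpr h
  obtain ⟨h16, h32⟩ := hY
  refine not_pow_dvd_c₄_c₆_int_two X ⟨?_, ?_⟩
  · -- `2⁸ ∣ c₄(M_X)`
    by_cases hc : (integralModelInt Y).c₄ = 0
    · have : (integralModelInt X).c₄ = 0 := by
        have h := h₄
        rw [hc, Int.cast_zero, mul_zero] at h
        exact_mod_cast h
      rw [this]; exact dvd_zero _
    · have hcQ : ((integralModelInt Y).c₄ : ℚ) ≠ 0 := by exact_mod_cast hc
      have hvY : (4 : ℤ) ≤ padicValInt 2 (integralModelInt Y).c₄ := by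
        have h := (padicValInt_dvd_iff (p := 2) 4 (integralModelInt Y).c₄).mp (by simpa using h16)
        rcases h with h | h
        · exact absurd h hc
        · exact_mod_cast h
      have hvX : (8 : ℤ) ≤ padicValRat 2 ((integralModelInt X).c₄ : ℚ) := by
        rw [h₄, padicValRat.mul (pow_ne_zero 4 ht) hcQ, padicValRat.pow, padicValRat.of_int]
        push_cast
        linarith
      rw [padicValRat.of_int] at hvX
      have h8 : 8 ≤ padicValInt 2 (integralModelInt X).c₄ := by exact_mod_cast hvX
      have h := (padicValInt_dvd_iff (p := 2) 8 (integralModelInt X).c₄).mpr (Or.inr h8)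
      simpa using h
  · -- `2¹¹ ∣ c₆(M_X)`
    by_cases hc : (integralModelInt Y).c₆ = 0
    · have : (integralModelInt X).c₆ = 0 := by
        have h := h₆
        rw [hc, Int.cast_zero, mul_zero, neg_zero] at h
        exact_mod_cast h
      rw [this]; exact dvd_zero _
    · have hcQ : ((integralModelInt Y).c₆ : ℚ) ≠ 0 := by exact_mod_cast hc
      have hvY : (5 : ℤ) ≤ padicValInt 2 (integralModelInt Y).c₆ := by
        have h := (padicValInt_dvd_iff (p := 2) 5 (integralModelInt Y).c₆).mp (by simpa using h32)
        rcases h with h | h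
        · exact absurd h hc
        · exact_mod_cast h
      have hvX : (11 : ℤ) ≤ padicValRat 2 ((integralModelInt X).c₆ : ℚ) := by
        rw [h₆, padicValRat.neg, padicValRat.mul (pow_ne_zero 6 ht) hcQ, padicValRat.pow,
          padicValRat.of_int]
        push_cast
        linarith
      rw [padicValRat.of_int] at hvX
      have h11 : 11 ≤ padicValInt 2 (integralModelInt X).c₆ := by exact_mod_cast hvX
      have h := (padicValInt_dvd_iff (p := 2) 11 (integralModelInt X).c₆).mpr (Or.inr h11)
      simpa using h

/-- **`u(C)` is a unit at the place over `2` for the twist by `−1` of a curve additive at `2` whose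
twist is again additive at `2`** (Pal 2012, Prop. 2.4 (Connell), `p = 2`, `d ≡ 3 (mod 4)`, case (iii):
"otherwise `v₂(Δ′) = v₂(Δ)`" — cases (i) `0,0,c` / `a,3,0` and (ii) have one of the two curves
semistable at `2`): for `V/ℚ` globally minimal with `2² ∣ N(V)` and any globally minimal `W = C • V^{(−1)}`
with `2² ∣ N(W)`, the scaling `u(C)` is a `2`-adic unit.  With `μ = u(C)`: `c₄(M_W) = μ⁻⁴c₄(M_V)`,
`c₆(M_W) = −μ⁻⁶c₆(M_V)`, both sides have `16 ∣ c₄`, `32 ∣ c₆`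
(`sixteen_dvd_c₄_and_thirtytwo_dvd_c₆_of_four_dvd_conductorNorm`), so `ord₂(μ) ≤ 0` and
`ord₂(μ⁻¹) ≤ 0` by `padicValRat_two_le_zero_of_c₄_c₆_eq`. [cite: Pal2012, Prop. 2.4 (Connell), case p = 2, d ≡ 3 (mod 4) (iii)]
[cite: Kraus1989, Prop. 2] [cite: SilvermanAEC2009, VII.1 Prop. 1.3(b)] -/
theorem valuation_u_eq_one_of_smul_quadraticTwist_negOne_two_of_four_dvd_conductorNorm
    (v : HeightOneSpectrum (𝓞 ℚ)) (hv2 : (primesEquiv v : ℕ) = 2) (hV : 2 ^ 2 ∣ V.conductorNorm ℤ)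
    (W : WeierstrassCurve ℚ) [W.IsElliptic] [W.IsGloballyMinimal] (hW : 2 ^ 2 ∣ W.conductorNorm ℤ)
    (C : VariableChange ℚ) (hC : C • V.quadraticTwist ((-1 : ℤ) : ℚ) = W) :
    v.valuation ℚ (C.u : ℚ) = 1 := by
  haveI : Fact (Nat.Prime 2) := ⟨Nat.prime_two⟩
  set M : WeierstrassCurve ℤ := integralModelInt V with hM
  set M' : WeierstrassCurve ℤ := integralModelInt W with hM'
  have hVM : M.map (Int.castRingHom ℚ) = V := map_integralModelInt V
  have hWM : M'.map (Int.castRingHom ℚ) = W := map_integralModelInt W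
  set μ : ℚ := (C.u : ℚ) with hμ
  have hμ0 : μ ≠ 0 := Units.ne_zero C.u
  -- the invariants of `W = C • V^{(−1)}`
  have h₄' : ((M'.c₄ : ℤ) : ℚ) = μ⁻¹ ^ 4 * ((M.c₄ : ℤ) : ℚ) := by
    have h := congrArg WeierstrassCurve.c₄ hC
    rw [variableChange_c₄, quadraticTwist_c₄, ← hVM, ← hWM, map_c₄, map_c₄, eq_intCast, eq_intCast,
      Units.val_inv_eq_inv_val] at h
    rw [← h]; push_cast; ring
  have h₆' : ((M'.c₆ : ℤ) : ℚ) = -(μ⁻¹ ^ 6 * ((M.c₆ : ℤ) : ℚ)) := by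
    have h := congrArg WeierstrassCurve.c₆ hC
    rw [variableChange_c₆, quadraticTwist_c₆, ← hVM, ← hWM, map_c₆, map_c₆, eq_intCast, eq_intCast,
      Units.val_inv_eq_inv_val] at h
    rw [← h]; push_cast; ring
  have h₄ : ((M.c₄ : ℤ) : ℚ) = μ ^ 4 * ((M'.c₄ : ℤ) : ℚ) := by
    rw [h₄']; field_simp
  have h₆ : ((M.c₆ : ℤ) : ℚ) = -(μ ^ 6 * ((M'.c₆ : ℤ) : ℚ)) := by
    rw [h₆']; field_simp
  -- `ord₂(μ) ≤ 0` and `ord₂(μ⁻¹) ≤ 0`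
  have hle : padicValRat 2 μ ≤ 0 :=
    padicValRat_two_le_zero_of_c₄_c₆_eq V W
      (W.sixteen_dvd_c₄_and_thirtytwo_dvd_c₆_of_four_dvd_conductorNorm hW) hμ0 h₄ h₆
  have hge : padicValRat 2 μ⁻¹ ≤ 0 :=
    padicValRat_two_le_zero_of_c₄_c₆_eq W V
      (V.sixteen_dvd_c₄_and_thirtytwo_dvd_c₆_of_four_dvd_conductorNorm hV) (inv_ne_zero hμ0) h₄' h₆'
  rw [padicValRat.inv] at hge
  have hval : padicValRat 2 μ = 0 := le_antisymm hle (by linarith)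
  -- hence `μ` is a `v`-adic unit
  have hgen : natGenerator v = 2 := hv2
  have h2v : ((2 : ℕ) : 𝓞 ℚ) ∈ v.asIdeal :=
    (Literature.NumberTheory.GaloisRepresentations.Rat.natCast_mem_asIdeal_iff v).mpr (by rw [hgen])
  have h := valuation_ratCast_eq_one_of_padicValRat_eq_zero (K := ℚ) (v := v) Nat.prime_two h2v hμ0
    hval
  simpa only [Rat.cast_id] using h

/-- **Pal 2012, Prop. 2.4/2.5 (Connell) at `d = −1`, both curves additive at `2`: the scaling is `±1`.**
For `V/ℚ` globally minimal with `2² ∣ N(V)` and ANY globally minimal model `W = C • V^{(−1)}` of the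
twist with `2² ∣ N(W)`, `u(C) = ±1`: `u(C)` is a unit at every finite place (odd places:
`valuation_u_eq_one_of_smul_quadraticTwist_of_odd_of_not_dvd`; the place over `2`:
`valuation_u_eq_one_of_smul_quadraticTwist_negOne_two_of_four_dvd_conductorNorm`), so
`u(C), u(C)⁻¹ ∈ 𝓞 ℚ = ℤ` (as in `u_eq_one_or_eq_neg_one_of_smul_quadraticTwist`).
[cite: Pal2012, Prop. 2.4 (Connell) and Prop. 2.5] [cite: SilvermanAEC2009, VII.1 Prop. 1.3(b) and VIII.8] -/
theorem u_eq_one_or_eq_neg_one_of_smul_quadraticTwist_negOne_of_four_dvd_conductorNorm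
    (hV : 2 ^ 2 ∣ V.conductorNorm ℤ) (W : WeierstrassCurve ℚ) [W.IsElliptic] [W.IsGloballyMinimal]
    (hW : 2 ^ 2 ∣ W.conductorNorm ℤ) (C : VariableChange ℚ)
    (hC : C • V.quadraticTwist ((-1 : ℤ) : ℚ) = W) : (C.u : ℚ) = 1 ∨ (C.u : ℚ) = -1 := by
  have hall : ∀ v : HeightOneSpectrum (𝓞 ℚ), v.valuation ℚ (C.u : ℚ) = 1 := by
    intro v
    by_cases hv2 : (primesEquiv v : ℕ) = 2
    · exact V.valuation_u_eq_one_of_smul_quadraticTwist_negOne_two_of_four_dvd_conductorNorm v hv2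
        hV W hW C hC
    · have hℓp : (primesEquiv v : ℕ).Prime := (primesEquiv v).2
      have hvd : ¬ ((primesEquiv v : ℕ) : ℤ) ∣ (-1 : ℤ) := fun hd' =>
        hℓp.one_lt.ne' (by exact_mod_cast Int.eq_one_of_dvd_one (by positivity) (dvd_neg.mp hd'))
      exact V.valuation_u_eq_one_of_smul_quadraticTwist_of_odd_of_not_dvd v hv2 hvd W C hC
  -- `u` and `u⁻¹` are integers
  have hu : (C.u : ℚ) ∈ (algebraMap (𝓞 ℚ) ℚ).range :=
    HeightOneSpectrum.mem_integers_of_valuation_le_one ℚ (C.u : ℚ) (fun v => (hall v).le)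
  have hui : (C.u : ℚ)⁻¹ ∈ (algebraMap (𝓞 ℚ) ℚ).range :=
    HeightOneSpectrum.mem_integers_of_valuation_le_one ℚ (C.u : ℚ)⁻¹
      (fun v => by rw [map_inv₀, hall v, inv_one])
  obtain ⟨y, hy⟩ := hu
  obtain ⟨yi, hyi⟩ := hui
  obtain ⟨U, hU⟩ : ∃ n : ℤ, (n : ℚ) = C.u :=
    ⟨Rat.ringOfIntegersEquiv y, (Rat.ringOfIntegersEquiv_apply_coe y).trans hy⟩
  obtain ⟨Ui, hUi⟩ : ∃ n : ℤ, (n : ℚ) = (C.u : ℚ)⁻¹ :=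
    ⟨Rat.ringOfIntegersEquiv yi, (Rat.ringOfIntegersEquiv_apply_coe yi).trans hyi⟩
  have hUU : Ui * U = 1 := by
    exact_mod_cast (show (Ui : ℚ) * U = 1 by rw [hU, hUi, inv_mul_cancel₀ (Units.ne_zero C.u)])
  rcases Int.eq_one_or_neg_one_of_mul_eq_one' hUU with ⟨-, h⟩ | ⟨-, h⟩
  · left; rw [← hU, h]; simp
  · right; rw [← hU, h]; simp

end WeierstrassCurve

/-! ## The discharge -/

namespace Literature.NumberTheory.EllipticCurves

open WeierstrassCurve

/-- **Connell–Pal: the minimal discriminant is unchanged by the `−1`-twist when both curves are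
additive at `2` — PROVED** (discharge of `connellPal_Δ_eq_of_negOne_twist_of_four_dvd_conductor`):
for globally minimal `W`, `W′` over `ℚ` with `2² ∣ N(W)`, `2² ∣ N(W′)` and `u • (W ⊗ (−1)) = W′`,
`Δ(W′) = Δ(W)`.  Assembled from `u = ±1`
(`u_eq_one_or_eq_neg_one_of_smul_quadraticTwist_negOne_of_four_dvd_conductorNorm`, Pal's `ũ = 1`:
Prop. 2.4 at the odd `p ∤ d` and at `p = 2`, `d ≡ 3 (mod 4)`, case (iii)) and
`Δ(W′) = u⁻¹² (−1)⁶ Δ(W)` (`variableChange_Δ`, `quadraticTwist_Δ`; Pal Remark 2.3).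
[cite: Pal2012, Prop. 2.4 (Connell), case p = 2, d ≡ 3 (mod 4) (iii), and «p odd, p ∤ d»; Remark 2.3]
[cite: Connell1999, §5.7.3] -/
theorem connellPal_Δ_eq_of_negOne_twist_of_four_dvd_conductor_holds :
    connellPal_Δ_eq_of_negOne_twist_of_four_dvd_conductor := by
  intro W W' _ _ _ _ u h4 h4' hu
  have hΔ : W'.Δ = (u.u : ℚ)⁻¹ ^ 12 * (((-1 : ℤ) : ℚ) ^ 6 * W.Δ) := by
    rw [← hu, WeierstrassCurve.variableChange_Δ, WeierstrassCurve.quadraticTwist_Δ,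
      Units.val_inv_eq_inv_val]
  rcases W.u_eq_one_or_eq_neg_one_of_smul_quadraticTwist_negOne_of_four_dvd_conductorNorm h4 W' h4'
    u hu with h | h
  · rw [hΔ, h]; push_cast; ring
  · rw [hΔ, h]; push_cast; ring

end Literature.NumberTheory.EllipticCurves

end
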